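import Summits.RiemannHypothesis.RiemannHypothesis.Theorems.PfPersistencePoleFreeIndex
import Summits.RiemannHypothesis.RiemannHypothesis.Theorems.OddSectorOddOneSignedWindowsOddEnergyUpper
import HarnessLib

/-!
# PF-persistence barrier: the planted real pair IS a negative — the `hNeg` binder of the
# REALPAIR-MONO / pole-free sub-index walls discharged (PROVED, RH-free)

Framing (page 1 of every `pub-rhpf` file): **long-odds MECHANISM / RIGIDITY SEARCH — nothing here is
a claim about RH.**  Every statement below is RH-free; `RiemannHypothesis` is never a hypothesis or a
conclusion.

The walls `no_evenMonotone_discriminator` (`…BarrierRealPair`, node REALPAIR-MONO = B-W5 of the cell's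
case DAG) and `no_subIndexOn_discriminator` / `no_subIndex_discriminator` /
`no_subIndexOnSet_discriminator` (`…PoleFreeIndex`, leaf G1.08 and the pole-free conjunct of G1.21c)
carry the binder `hNeg : realPairDatum η ∈ Neg` — the NEGATIVITY of the control "ζ with a planted real
pair `{1/2 ± η}`" was observatory DATA, never proved.  This file PROVES it, for every `η ≠ 0`, with an
explicit ODD trial function: the derivative `ψ_a = φ_a′` of the truncated Riemann kernel
`φ_a = Φχ_a` (`…OddSectorOddOneSignedWindowsOddEnergyUpper`).  By the explicit formula
`‖Q_ζ(ψ_a)‖ ≤ C exp(−(π/2)e^{2(a−1)})` (`OddSector.exists_norm_weilQuadratic_deriv_phiCut_le`,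
RH-free), while on odd tests the planted pair LOWERS the form by `2‖ψ̂_a(1/2+η)‖²`
(`realPairDatum_re_quadratic_of_isOdd`) and `ψ̂_a(1/2+η) = −η φ̂_a(1/2+η)` (`weilMellin_deriv`) with
`φ̂_a(1/2+η) = ∫ Φχ_a e^{ηt} ≥ 2 (min_{[-1,1]} Φ) e^{−|η|}` uniformly in `a ≥ 2` (`φ_a ≥ 0`,
`φ_a = Φ` on `[-1, 1]`).  Hence `Re Q_pair(ψ_a) ≤ C exp(−(π/2)e^{2(a−1)}) − 2η²(2m₀e^{−|η|})² < 0`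
for all large `a`:

* `eventually_re_quadratic_realPairDatum_deriv_phiCut_neg` — the odd trial has NEGATIVE pair energy at
  every large window (`η ≠ 0`);
* `not_positivity_realPairDatum` — **`realPairDatum η` is not Weil-positive** (`η ≠ 0`), and
  `eventually_not_positivityOn_realPairDatum` — window positivity fails at every large cutoff;
* BINDER-FREE WALLS: with the canonical negative class `{F | ¬ F.Positivity}` (or any `Neg` containing
  it) — `no_evenMonotone_discriminator_of_subset`, `no_subIndexOn_discriminator_of_subset`,
  `no_subIndex_discriminator_of_subset`, `no_subIndexOnSet_discriminator_of_subset`.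

(`η = 0` is excluded for cause: `realPairTerm 0` vanishes on odd autocorrelations, and a double zero
AT `1/2` is compatible with positivity.)  References: Bombieri 2000 (explicit formula, Thm 2); Weil 1952.
-/

set_option linter.dupNamespace false

noncomputable section

open Set MeasureTheory Filter Complex
open scoped Real Topology ComplexConjugate

namespace Summit.RiemannHypothesis.RiemannHypothesis.Theorems.PfPersistenceBarrier

open Literature.NumberTheory.LFunctions
open ExplicitDatum
open Summit.RiemannHypothesis.RiemannHypothesis.Theorems.GroundStatesConvergeToXi
open Summit.RiemannHypothesis.RiemannHypothesis.Theorems.OddSector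

/-- The truncated Riemann kernel `φ_a = Φ χ_a` in the spelling of
`…OddSectorOddOneSignedWindowsOddEnergyUpper` (`χ_a = Literature.Analysis.Calculus.cutoff a`). -/
local notation "φ[" a "]" => (fun t : ℝ => (2 : ℂ) * LagariasMontague.Psic (2 * t) *
  ((Literature.Analysis.Calculus.cutoff a t : ℝ) : ℂ))

/-! ## A uniform lower bound for Mellin values of nonnegative tests at real points -/

/-- For a real test `r ≥ 0` with `r ≥ m` on `[-1, 1]`: `‖r̂(1/2+η)‖ ≥ 2 m e^{-|η|}`
(`r̂(1/2+η) = ∫ r(t) e^{ηt} dt ≥ ∫_{[-1,1]} m e^{-|η|}`). [folklore] -/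
theorem norm_weilMellin_ofReal_half_add_ge {r : ℝ → ℝ} (hc : Continuous r)
    (hs : HasCompactSupport r) (h0 : ∀ t, 0 ≤ r t) {m : ℝ} (hm : ∀ t ∈ Icc (-1 : ℝ) 1, m ≤ r t)
    (η : ℝ) :
    2 * m * Real.exp (-|η|) ≤ ‖weilMellin (fun t => ((r t : ℝ) : ℂ)) ((1 / 2 + η : ℝ) : ℂ)‖ := by
  have hM : weilMellin (fun t => ((r t : ℝ) : ℂ)) ((1 / 2 + η : ℝ) : ℂ) =
      ((∫ t : ℝ, r t * Real.exp (η * t) : ℝ) : ℂ) := by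
    unfold weilMellin
    rw [← integral_complex_ofReal]
    congr 1 with t
    have e : (((1 / 2 + η : ℝ) : ℂ) - 1 / 2) * (t : ℂ) = ((η * t : ℝ) : ℂ) := by push_cast; ring
    rw [e, ← Complex.ofReal_exp]
    push_cast
    ring
  rw [hM, Complex.norm_real, Real.norm_eq_abs]
  refine le_trans ?_ (le_abs_self _)
  have hint : Integrable (fun t : ℝ => r t * Real.exp (η * t)) :=
    (hc.mul (Real.continuous_exp.comp (continuous_const.mul continuous_id))).integrable_of_hasCompactSupport
      (hs.mul_right (f' := fun t : ℝ => Real.exp (η * t)))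
  have hind : Integrable
      (fun t : ℝ => (Icc (-1 : ℝ) 1).indicator (fun _ => m * Real.exp (-|η|)) t) :=
    (integrableOn_const (by simp [Real.volume_Icc])).integrable_indicator measurableSet_Icc
  have hpt : ∀ t : ℝ,
      (Icc (-1 : ℝ) 1).indicator (fun _ => m * Real.exp (-|η|)) t ≤ r t * Real.exp (η * t) := by
    intro t
    by_cases ht : t ∈ Icc (-1 : ℝ) 1
    · rw [indicator_of_mem ht]
      have h1 : -|η| ≤ η * t := by
        have : |η * t| ≤ |η| := by
          rw [abs_mul]
          exact mul_le_of_le_one_right (abs_nonneg _) (abs_le.2 ⟨ht.1, ht.2⟩)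
        exact (abs_le.1 this).1
      exact mul_le_mul (hm t ht) (Real.exp_le_exp.2 h1) (Real.exp_pos _).le (h0 t)
    · rw [indicator_of_notMem ht]
      exact mul_nonneg (h0 t) (Real.exp_pos _).le
  calc 2 * m * Real.exp (-|η|)
      = ∫ t, (Icc (-1 : ℝ) 1).indicator (fun _ => m * Real.exp (-|η|)) t := by
        rw [integral_indicator_const _ measurableSet_Icc, Real.volume_real_Icc, smul_eq_mul,
          max_eq_left (by norm_num)]
        ring
    _ ≤ ∫ t, r t * Real.exp (η * t) := integral_mono hind hint hpt

/-! ## The truncated kernel `φ_a` and its derivative: Mellin values at `1/2 + η` -/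

/-- `φ_a = Φ · χ_a` pointwise, `Φ = weilThetaPhi`. [folklore] -/
theorem phiCut_apply (a t : ℝ) :
    φ[a] t = ((weilThetaPhi t * Literature.Analysis.Calculus.cutoff a t : ℝ) : ℂ) := by
  simp only [LagariasMontague.Psic, weilThetaPhi_eq_two_mul_Psi]
  push_cast
  ring

/-- **`φ̂_a(1/2+η) ≥ m e^{-|η|}` uniformly in `a ≥ 2`** (`m = 2 min_{[-1,1]} Φ > 0`). [folklore] -/
theorem exists_norm_weilMellin_phiCut_ge :
    ∃ m : ℝ, 0 < m ∧ ∀ η a : ℝ, 2 ≤ a →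
      m * Real.exp (-|η|) ≤ ‖weilMellin φ[a] ((1 / 2 + η : ℝ) : ℂ)‖ := by
  obtain ⟨t₀, -, hmin⟩ := (isCompact_Icc : IsCompact (Icc (-1 : ℝ) 1)).exists_isMinOn
    (nonempty_Icc.2 (by norm_num)) continuous_weilThetaPhi.continuousOn
  refine ⟨2 * weilThetaPhi t₀, by positivity [weilThetaPhi_pos t₀], fun η a ha => ?_⟩
  set r : ℝ → ℝ := fun t => weilThetaPhi t * Literature.Analysis.Calculus.cutoff a t with hr
  have he : φ[a] = fun t => ((r t : ℝ) : ℂ) := funext (phiCut_apply a)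
  have hc : Continuous r :=
    continuous_weilThetaPhi.mul (Literature.Analysis.Calculus.contDiff_cutoff a (n := 0)).continuous
  have hs : HasCompactSupport r := by
    refine HasCompactSupport.intro (isCompact_Icc (a := -a) (b := a)) fun t ht => ?_
    have hta : a ≤ |t| := by
      simp only [mem_Icc, not_and_or, not_le] at ht
      rcases ht with h | h
      · linarith [neg_abs_le t]
      · linarith [le_abs_self t]
    simp [hr, Literature.Analysis.Calculus.cutoff_eq_zero hta]
  have h0 : ∀ t, 0 ≤ r t := fun t =>
    mul_nonneg (weilThetaPhi_pos t).le (Literature.Analysis.Calculus.cutoff_nonneg a t)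
  have hm : ∀ t ∈ Icc (-1 : ℝ) 1, weilThetaPhi t₀ ≤ r t := by
    intro t ht
    have h1 : Literature.Analysis.Calculus.cutoff a t = 1 :=
      Literature.Analysis.Calculus.cutoff_eq_one (by
        have := abs_le.2 ⟨ht.1, ht.2⟩
        linarith)
    simp only [hr, h1, mul_one]
    exact hmin ht
  rw [he, mul_assoc, ← mul_assoc]
  exact norm_weilMellin_ofReal_half_add_ge hc hs h0 hm η

/-- **`‖ψ̂_a(1/2+η)‖ = |η| ‖φ̂_a(1/2+η)‖`** for the odd trial `ψ_a = φ_a′` (`weilMellin_deriv`). [folklore] -/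
theorem norm_weilMellin_deriv_phiCut (a η : ℝ) :
    ‖weilMellin (deriv φ[a]) ((1 / 2 + η : ℝ) : ℂ)‖ =
      |η| * ‖weilMellin φ[a] ((1 / 2 + η : ℝ) : ℂ)‖ := by
  rw [weilMellin_deriv (isWeilTest_phiCut a), norm_mul, norm_neg]
  congr 1
  have e : ((1 / 2 + η : ℝ) : ℂ) - 1 / 2 = (η : ℂ) := by push_cast; ring
  rw [e, Complex.norm_real, Real.norm_eq_abs]

/-! ## The planted real pair has negative odd energy at every large window -/

/-- **The odd trial has NEGATIVE pair energy at every large window** (`η ≠ 0`):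
`Re Q_pair(ψ_a) = Re Q_ζ(ψ_a) − 2‖ψ̂_a(1/2+η)‖² ≤ C exp(−(π/2)e^{2(a−1)}) − 2η²m²e^{−2|η|} < 0`
eventually.  RH-free. [folklore] -/
theorem eventually_re_quadratic_realPairDatum_deriv_phiCut_neg {η : ℝ} (hη : η ≠ 0) :
    ∀ᶠ a : ℝ in atTop, ((realPairDatum η).quadratic (deriv φ[a])).re < 0 := by
  obtain ⟨C, -, hQ⟩ := exists_norm_weilQuadratic_deriv_phiCut_le
  obtain ⟨m, hm, hM⟩ := exists_norm_weilMellin_phiCut_ge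
  have hη' : 0 < |η| := abs_pos.2 hη
  set κ : ℝ := 2 * (|η| * (m * Real.exp (-|η|))) ^ 2 with hκdef
  have hκ : 0 < κ := by positivity
  have h2a : Tendsto (fun a : ℝ => 2 * (a - 1)) atTop atTop :=
    tendsto_atTop_atTop.2 fun b => ⟨b / 2 + 1, fun a ha => by linarith⟩
  have hexp : Tendsto (fun a : ℝ => π / 2 * Real.exp (2 * (a - 1))) atTop atTop :=
    (Real.tendsto_exp_atTop.comp h2a).const_mul_atTop (by positivity)
  have hneg : Tendsto (fun a : ℝ => Real.exp (-(π / 2 * Real.exp (2 * (a - 1))))) atTop (𝓝 0) :=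
    Real.tendsto_exp_atBot.comp (tendsto_neg_atTop_atBot.comp hexp)
  have hlim : Tendsto (fun a : ℝ => C * Real.exp (-(π / 2 * Real.exp (2 * (a - 1))))) atTop
      (𝓝 0) := by
    simpa using hneg.const_mul C
  filter_upwards [eventually_ge_atTop (2 : ℝ), hlim.eventually (gt_mem_nhds hκ)] with a ha hlt
  have hψ : IsWeilTest (deriv φ[a]) := (isWeilTest_phiCut a).deriv
  have hodd : IsOdd (deriv φ[a]) := fun t => deriv_phiCut_neg a t
  rw [realPairDatum_re_quadratic_of_isOdd hψ hodd, zetaDatum_quadratic]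
  have h1 : (weilQuadratic (deriv φ[a])).re ≤ C * Real.exp (-(π / 2 * Real.exp (2 * (a - 1)))) :=
    (Complex.re_le_norm _).trans (hQ a (by linarith))
  have h2 : κ ≤ 2 * ‖weilMellin (deriv φ[a]) ((1 / 2 + η : ℝ) : ℂ)‖ ^ 2 := by
    have h3 : |η| * (m * Real.exp (-|η|)) ≤ ‖weilMellin (deriv φ[a]) ((1 / 2 + η : ℝ) : ℂ)‖ := by
      rw [norm_weilMellin_deriv_phiCut]
      exact mul_le_mul_of_nonneg_left (hM η a ha) hη'.le
    rw [hκdef]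
    have h4 : 0 ≤ |η| * (m * Real.exp (-|η|)) := by positivity
    nlinarith [h3, h4]
  linarith

/-- **At every large window there is an ODD test of the window with negative pair energy** (`η ≠ 0`). [folklore] -/
theorem eventually_exists_odd_re_quadratic_realPairDatum_neg {η : ℝ} (hη : η ≠ 0) :
    ∀ᶠ a : ℝ in atTop, ∃ g : ℝ → ℂ, IsWeilTest g ∧ IsOdd g ∧ tsupport g ⊆ Icc (-a) a ∧
      ((realPairDatum η).quadratic g).re < 0 := by
  filter_upwards [eventually_re_quadratic_realPairDatum_deriv_phiCut_neg hη] with a ha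
  exact ⟨deriv φ[a], (isWeilTest_phiCut a).deriv, fun t => deriv_phiCut_neg a t,
    tsupport_deriv_subset.trans (tsupport_phiCut_subset a), ha⟩

/-- **THE PLANTED REAL PAIR IS NOT WEIL-POSITIVE (PROVED, RH-free)**, for every `η ≠ 0`. [folklore] -/
theorem not_positivity_realPairDatum {η : ℝ} (hη : η ≠ 0) : ¬ (realPairDatum η).Positivity := by
  intro hpos
  obtain ⟨a, g, hg, -, -, hneg⟩ :=
    (eventually_exists_odd_re_quadratic_realPairDatum_neg hη).exists
  exact absurd (hpos g hg) (not_le.2 hneg)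

/-- Window positivity of the planted real pair FAILS at every large cutoff (`η ≠ 0`). [folklore] -/
theorem eventually_not_positivityOn_realPairDatum {η : ℝ} (hη : η ≠ 0) :
    ∀ᶠ a : ℝ in atTop, ¬ (realPairDatum η).PositivityOn a := by
  filter_upwards [eventually_exists_odd_re_quadratic_realPairDatum_neg hη] with a ha hpos
  obtain ⟨g, hg, -, hsupp, hneg⟩ := ha
  exact absurd (hpos g hg hsupp) (not_le.2 hneg)

/-- The planted real pair lies in the CANONICAL negative class `{F | ¬ F.Positivity}` (`η ≠ 0`);
for `ζ` itself membership is `¬ RiemannHypothesis` (`zetaDatum_positivity_iff_riemannHypothesis`). [folklore] -/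
theorem realPairDatum_mem_not_positivity {η : ℝ} (hη : η ≠ 0) :
    realPairDatum η ∈ {F : ExplicitDatum | ¬ F.Positivity} :=
  not_positivity_realPairDatum hη

/-! ## Binder-free walls: the negative class only has to contain the non-positive data -/

/-- **WALL REALPAIR-MONO, BINDER-FREE (PROVED, RH-free)**: no even-monotone criterion discriminates
`ζ` from any negative class containing every non-Weil-positive datum. [folklore] -/
theorem no_evenMonotone_discriminator_of_subset {P : ExplicitDatum → Prop} (hP : IsEvenMonotone P)
    {Neg : Set ExplicitDatum} (hNeg : {F : ExplicitDatum | ¬ F.Positivity} ⊆ Neg) :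
    ¬ Discriminates P zetaDatum Neg :=
  no_evenMonotone_discriminator hP (hNeg (realPairDatum_mem_not_positivity one_ne_zero))

/-- In particular for the canonical negative class itself. [folklore] -/
theorem no_evenMonotone_discriminator_not_positivity {P : ExplicitDatum → Prop}
    (hP : IsEvenMonotone P) :
    ¬ Discriminates P zetaDatum {F : ExplicitDatum | ¬ F.Positivity} :=
  no_evenMonotone_discriminator_of_subset hP subset_rfl

/-- **POLE-FREE SUB-INDEX WALL, BINDER-FREE** (single cutoff, every codimension `k`). [folklore] -/
theorem no_subIndexOn_discriminator_of_subset (R : (ℝ → ℂ) → ℝ) (k : ℕ) (A : ℝ)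
    {Neg : Set ExplicitDatum} (hNeg : {F : ExplicitDatum | ¬ F.Positivity} ⊆ Neg) :
    ¬ Discriminates (fun F ↦ SubIndexOn R k F A) zetaDatum Neg :=
  no_evenMonotone_discriminator_of_subset (subIndexOn_isEvenMonotone R k A) hNeg

/-- **POLE-FREE SUB-INDEX WALL, BINDER-FREE** (all cutoffs, cutoff-dependent reference and codimension). [folklore] -/
theorem no_subIndex_discriminator_of_subset (R : ℝ → (ℝ → ℂ) → ℝ) (k : ℝ → ℕ)
    {Neg : Set ExplicitDatum} (hNeg : {F : ExplicitDatum | ¬ F.Positivity} ⊆ Neg) :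
    ¬ Discriminates (fun F ↦ SubIndex R k F) zetaDatum Neg :=
  no_evenMonotone_discriminator_of_subset (subIndex_isEvenMonotone R k) hNeg

/-- **POLE-FREE SUB-INDEX WALL, BINDER-FREE** (any set of cutoffs). [folklore] -/
theorem no_subIndexOnSet_discriminator_of_subset (R : ℝ → (ℝ → ℂ) → ℝ) (k : ℝ → ℕ) (S : Set ℝ)
    {Neg : Set ExplicitDatum} (hNeg : {F : ExplicitDatum | ¬ F.Positivity} ⊆ Neg) :
    ¬ Discriminates (fun F ↦ SubIndexOnSet R k S F) zetaDatum Neg :=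
  no_evenMonotone_discriminator_of_subset (subIndexOnSet_isEvenMonotone R k S) hNeg

end Summit.RiemannHypothesis.RiemannHypothesis.Theorems.PfPersistenceBarrier
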